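import Summits.QuantumFields.YangMills.Theorems.IR.AfPincerUcSharpOnset
import Summits.QuantumFields.YangMills.Theorems.IR.Negative.TypShellCondFalseFixedMesh

/-!
# Crux `IR` (stmt-QuantumFields-19354), slot «sharp merge I♯_SC» (sha16 28967a1bf60ad397, `Cruxes/IR/Lines/af_pincer_Uc_sharp.lean`):
# the PINNING hypothesis `LowerBounds` of `stub_onsetSharpSC` is LOAD-BEARING — the unpinned twin is FALSE outright;
# and the EXACT kill-world of I♯_SC (Negative lane, disprove-1 g8, `--supports stmt-QuantumFields-19354`)

The registered open stub is `stub_onsetSharpSC : AfPincerUc.SharpOnset.OnsetSharpUKPcSC` (I♯_SC): on the simply connected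
family, for every `(G, r)` and every positive unit map `a → 0` CARRYING `LowerBounds G r a`, some admissible `(n, ε)` such that
for every rarity budget `δ > 0`, for all large `β`, the typical format `TypShellCondUKPc` holds at SOME mesh `b ≥ 1` with
`a β · b < T(δ)`.  The only universally quantified datum that is not excluded-as-junk by admissibility (`IsCompactSimpleLieGroup`,
faithful `LatticeRep`) is the unit map `a`; it is constrained only by `LowerBounds` (the `Q2`/`Q3` lower bounds at spacing
`a(β)`), which no seat can presently construct or refute for any `a` (it is weak-coupling non-triviality).  This file proves
that this constraint carries the WHOLE content of the stub as far as `a` is concerned: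

* `OnsetSharpUKPcSCFree` / `OnsetSharpUKPcFree` — I♯_SC with the hypothesis `LowerBounds G r a` DELETED (everything else
  verbatim; SC family ∕ all admissible `G`);
* `unpinnedUnit` — a PARASITIC UNIT MAP for `SU(2)`: `a(β) = 1 / (M(β) + 1)` where `M(β)` (`floorIdx`) is a diagonal
  index of the certified fixed-mesh onset floor (`FixedMesh.typOnsetFloor_SU2`, p510418: for the fundamental representation,
  at budgets `ε = 1/16`, `δ = floorBudget n`, format T fails at every mesh `b ≤ B` once `β ≥ β₁(n, B)`); `M(β) → ∞`, so
  `a > 0`, `a → 0`; and for EVERY window `n`, every `ε ≤ 1/16` (all admissible `ε`, `sixteen_mul_eps_lt_one`) and every `T`,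
  for all large `β` the format `TypShellCondUKPc` FAILS at EVERY mesh `b ≥ 1` with `a β · b < T` (`unpinnedUnit_kills`;
  ε-monotonicity of clause (i), `typShellCondUKPc_mono_eps`, makes one floor serve all admissible `ε`);
* `not_onsetSharpUKPcFree : ¬ OnsetSharpUKPcFree` (unconditional) and
  `not_onsetSharpUKPcSCFree_of_sc : SimplyConnectedSpace SU(2) → ¬ OnsetSharpUKPcSCFree` (the SC input is discharged in the
  companion `OnsetSharpFalseOfUnpinnedUnitSC.lean` by the tree's `simplyConnectedSpace_su2`, kept apart for Theses-cone hygiene);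
* `SubscaleFailureSC` + `subscaleFailureSC_iff_not : SubscaleFailureSC ↔ ¬ OnsetSharpUKPcSC` — the EXACT kill-world of the
  registered stub («one pinned simply connected `(G, r, a)` at which, for every admissible `(n, ε)`, some budget `δ > 0`
  sees the format fail at every mesh below `T / a(β)`, frequently in `β`, for every `T`» — NO requirement that the format hold
  at a larger mesh), and `subscaleFailureSC_of_lateOnset` — the §5 hook of record (`AfPincerUc.LateOnsetAt` at every admissible
  `(n, ε)`, `not_onsetSharpUKPcSC_of_lateOnsetAt`) is the special case with that extra requirement.

READING (numbers, not adjectives).  `unpinnedUnit` realises `SubscaleFailureSC` MINUS `LowerBounds` in the kernel: `1/a(β) = M(β)+1`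
while the certified onset floor at `β` is `≥ M(β)²` meshes, so every mesh below `T/a(β) ≤ M(β)²` (`M(β) ≥ 2T+1`) is frozen out.
Hence any proof of `stub_onsetSharpSC` must USE `LowerBounds G r a` quantitatively — it must turn the `Q2`∕`Q3` floor at spacing
`a(β)` into an upper bound `b⋆(β; n, ε, δ) < T(δ) / a(β)` on the typical onset mesh (the onset is `O_δ(ξ)` in a unit where
`ξ ≍ 1/a`); a proof that never touches `LowerBounds` would prove `OnsetSharpUKPcSCFree`, refuted here.  Verdict of record for the
slot is unchanged: (B) NOT REFUTED — `SubscaleFailureSC` itself needs a pinned `a` (memo `pub/ym-beyond/ym-19354-disprove-1/NOT-REFUTED.md` §13).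

Elementary given the tree (Mathlib + landed Theorems modules; no named facts as hypotheses); no `sorry`;
axioms ⊆ {`propext`, `Classical.choice`, `Quot.sound`}.  Nothing here asserts a Theses statement.
-/

set_option autoImplicit false

noncomputable section

open Filter Topology MeasureTheory
open scoped SchwartzMap
open Literature.MathematicalPhysics.QuantumFieldTheory Literature.MathematicalPhysics.QuantumLattice
open Summit.QuantumFields.YangMills.Cruxes.OSLegsFromFemtoAndGap.DlrCollarTransfer (LowerBounds)
open Summit.QuantumFields.YangMills.Cruxes.IR.ShellTempered (windowCellsPlus)
open Summit.QuantumFields.YangMills.Cruxes.IR.FixedMesh (ClauseI typOnsetFloor_SU2 fundRepSU2 sixteen_mul_eps_lt_one)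

namespace Summit.QuantumFields.YangMills.Cruxes.IR.AfPincerUc.SharpOnset

open Summit.QuantumFields.YangMills.Cruxes.IR.AfPincerUc


/-! ## §1 The unpinned twins of I♯_SC (hypothesis `LowerBounds G r a` deleted, everything else verbatim) -/

/-- **I♯_SC minus `LowerBounds`** — `OnsetSharpUKPcSC` with the pinning hypothesis `LowerBounds G r a` DELETED. -/
def OnsetSharpUKPcSCFree : Prop :=
  ∀ (G : Type) [Group G] [TopologicalSpace G] [IsTopologicalGroup G] [CompactSpace G],
    IsCompactSimpleLieGroup G → SimplyConnectedSpace G →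
    letI : MeasurableSpace G := borel G; haveI : BorelSpace G := ⟨rfl⟩;
    ∀ (r : LatticeRep G) (a : ℝ → ℝ), (∀ β, 0 < a β) → Tendsto a atTop (𝓝 0) →
      ∃ (n : ℕ) (ε : ℝ), 1 ≤ n ∧ 0 ≤ ε ∧ ε * OnsetFormats.shellCount n ≤ 3 / 4 ∧
        ∀ δ : ℝ, 0 < δ → ∃ T β₂ : ℝ, ∀ β : ℝ, β₂ ≤ β →
          ∃ b : ℕ, 1 ≤ b ∧ a β * (b : ℝ) < T ∧ TypShellCondUKPc r.ρ β b n ε δ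

/-- **I♯ minus `LowerBounds`, all admissible `G`** (no `SimplyConnectedSpace` binder either). -/
def OnsetSharpUKPcFree : Prop :=
  ∀ (G : Type) [Group G] [TopologicalSpace G] [IsTopologicalGroup G] [CompactSpace G],
    IsCompactSimpleLieGroup G →
    letI : MeasurableSpace G := borel G; haveI : BorelSpace G := ⟨rfl⟩;
    ∀ (r : LatticeRep G) (a : ℝ → ℝ), (∀ β, 0 < a β) → Tendsto a atTop (𝓝 0) →
      ∃ (n : ℕ) (ε : ℝ), 1 ≤ n ∧ 0 ≤ ε ∧ ε * OnsetFormats.shellCount n ≤ 3 / 4 ∧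
        ∀ δ : ℝ, 0 < δ → ∃ T β₂ : ℝ, ∀ β : ℝ, β₂ ≤ β →
          ∃ b : ℕ, 1 ≤ b ∧ a β * (b : ℝ) < T ∧ TypShellCondUKPc r.ρ β b n ε δ

/-- The unpinned SC twin is a STRENGTHENING of the registered stub (it serves every positive unit map `a → 0`). -/
theorem onsetSharpUKPcSC_of_free (h : OnsetSharpUKPcSCFree) : OnsetSharpUKPcSC := by
  intro G _ _ _ _ hG hsc
  letI : MeasurableSpace G := borel G
  haveI : BorelSpace G := ⟨rfl⟩
  intro r a ha hat _
  exact h G hG hsc r a ha hat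

/-- The all-`G` unpinned twin implies the SC one. -/
theorem onsetSharpUKPcSCFree_of_free (h : OnsetSharpUKPcFree) : OnsetSharpUKPcSCFree := by
  intro G _ _ _ _ hG _
  letI : MeasurableSpace G := borel G
  haveI : BorelSpace G := ⟨rfl⟩
  intro r a ha hat
  exact h G hG r a ha hat


/-! ## §2 Monotonicity of the format in the mixing budget `ε` -/

section Mono

variable {G : Type} [Group G] [TopologicalSpace G] [IsTopologicalGroup G] [CompactSpace G]
  [MeasurableSpace G] [BorelSpace G] {N : ℕ}

/-- Clause (i) is monotone in `ε`. -/
theorem clauseI_mono {ρ : G →* Matrix (Fin N) (Fin N) ℂ} {β : ℝ} {w : Fin 4 → ℤ → ℤ} {n : ℕ} {ε ε' : ℝ}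
    (hle : ε ≤ ε') {Typ : (Fin 4 → ℤ) → Set (LGConfig 4 G)} (h : ClauseI ρ β w n ε Typ) :
    ClauseI ρ β w n ε' Typ :=
  fun Y hY h0 σ σ' h1 h2 f hf hm hb => (h Y hY h0 σ σ' h1 h2 f hf hm hb).trans hle

/-- The format `TypShellCondUKPc` is monotone in `ε` (same class `Typ`; clauses (ii), (iii) untouched). -/
theorem typShellCondUKPc_mono_eps {ρ : G →* Matrix (Fin N) (Fin N) ℂ} {β : ℝ} {b n : ℕ} {ε ε' δ : ℝ}
    (hle : ε ≤ ε') (h : TypShellCondUKPc ρ β b n ε δ) : TypShellCondUKPc ρ β b n ε' δ := by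
  intro w hw
  obtain ⟨Typ, hloc, hi, hii, hiii⟩ := h w hw
  exact ⟨Typ, hloc, fun c₀ => clauseI_mono hle (hi c₀), hii, hiii⟩

end Mono

/-- Admissible `(n, ε)` (`0 ≤ ε`, `ε · shellCount n ≤ 3/4`) have `ε ≤ 1/16`. -/
theorem eps_le_sixteenth {n : ℕ} {ε : ℝ} (hε0 : 0 ≤ ε) (hM : ε * OnsetFormats.shellCount n ≤ 3 / 4) :
    ε ≤ 1 / 16 := by
  have h := sixteen_mul_eps_lt_one (shellCount_lt_one_of_le hM) hε0
  linarith


/-! ## §3 The parasitic unit map of `SU(2)` built from the certified onset floor -/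

section Unpinned

/-- The rarity budget at which the floor is read: `1 / (8 (#windowCellsPlus n + 1))`. -/
def floorBudget (n : ℕ) : ℝ := 1 / (8 * (((windowCellsPlus n).card : ℝ) + 1))

/-- `floorBudget n > 0`. -/
theorem floorBudget_pos (n : ℕ) : 0 < floorBudget n := by
  unfold floorBudget; positivity

/-- `4 · #windowCellsPlus n · floorBudget n < 1` (the floor's rarity hypothesis). -/
theorem floorBudget_lt (n : ℕ) : 4 * ((windowCellsPlus n).card : ℝ) * floorBudget n < 1 := by
  set k : ℝ := ((windowCellsPlus n).card : ℝ) with hk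
  have hk0 : 0 ≤ k := Nat.cast_nonneg _
  unfold floorBudget
  rw [show 4 * k * (1 / (8 * (k + 1))) = (4 * k) / (8 * (k + 1)) by ring, div_lt_one (by positivity)]
  linarith

variable [MeasurableSpace (Matrix.specialUnitaryGroup (Fin 2) ℂ)] [BorelSpace (Matrix.specialUnitaryGroup (Fin 2) ℂ)]

/-- The certified floor at `ε = 1/16`, `δ = floorBudget n`: `∃ β₁ ∀ β ≥ β₁`, format T fails at every mesh `1 ≤ b ≤ B`. -/
theorem floor_exists (n B : ℕ) : ∃ β₁ : ℝ, ∀ β : ℝ, β₁ ≤ β → ∀ b : ℕ, 1 ≤ b → b ≤ B →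
    ¬ OnsetFormats.TypShellCond (fundamentalRep (Fin 2)) β b n (1 / 16) (floorBudget n) :=
  typOnsetFloor_SU2 n (ε := 1 / 16) (by norm_num) (by norm_num) (floorBudget_pos n).le (floorBudget_lt n) B

/-- A threshold `β₁(n, B)` of the floor (chosen). -/
def floorThr (n B : ℕ) : ℝ := Classical.choose (floor_exists n B)

/-- Specification of `floorThr`. -/
theorem floorThr_spec (n B : ℕ) : ∀ β : ℝ, floorThr n B ≤ β → ∀ b : ℕ, 1 ≤ b → b ≤ B →
    ¬ OnsetFormats.TypShellCond (fundamentalRep (Fin 2)) β b n (1 / 16) (floorBudget n) :=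
  Classical.choose_spec (floor_exists n B)

/-- `FloorOK β m`: at `β`, every window `n ≤ m` is frozen out up to mesh `m²`. -/
def FloorOK (β : ℝ) (m : ℕ) : Prop := ∀ n : ℕ, n ≤ m → floorThr n (m * m) ≤ β

/-- The finite maximum of the thresholds entering `FloorOK β m`. -/
def floorThrMax (m : ℕ) : ℝ := (Finset.range (m + 1)).sup' ⟨0, by simp⟩ fun n => floorThr n (m * m)

/-- `FloorOK β m` holds once `β ≥ floorThrMax m`. -/
theorem floorOK_of_le {β : ℝ} {m : ℕ} (h : floorThrMax m ≤ β) : FloorOK β m := by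
  intro n hn
  have hmem : n ∈ Finset.range (m + 1) := Finset.mem_range.2 (Nat.lt_succ_of_le hn)
  exact (Finset.le_sup' (fun n => floorThr n (m * m)) hmem).trans h

open scoped Classical in
/-- **The diagonal floor index** `M(β)`: the largest `m ≤ ⌊β⌋₊` with `FloorOK β m`. -/
def floorIdx (β : ℝ) : ℕ := Nat.findGreatest (FloorOK β) ⌊β⌋₊

/-- Any `m ≤ β` with `FloorOK β m` is below the index. -/
theorem le_floorIdx {β : ℝ} {m : ℕ} (hm : (m : ℝ) ≤ β) (hP : FloorOK β m) : m ≤ floorIdx β := by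
  classical
  exact Nat.le_findGreatest (Nat.le_floor hm) hP

/-- The index satisfies `FloorOK` as soon as it is non-zero. -/
theorem floorOK_floorIdx {β : ℝ} (h : floorIdx β ≠ 0) : FloorOK β (floorIdx β) := by
  classical
  exact Nat.findGreatest_of_ne_zero rfl h

/-- `M(β) → ∞`. -/
theorem tendsto_floorIdx : Tendsto floorIdx atTop atTop := by
  refine tendsto_atTop_atTop.2 fun m => ⟨max (m : ℝ) (floorThrMax m), fun β hβ => ?_⟩
  exact le_floorIdx ((le_max_left _ _).trans hβ) (floorOK_of_le ((le_max_right _ _).trans hβ))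

/-- **The parasitic unit map** `a(β) = 1 / (M(β) + 1)`. -/
def unpinnedUnit (β : ℝ) : ℝ := ((floorIdx β : ℝ) + 1)⁻¹

/-- `unpinnedUnit β > 0`. -/
theorem unpinnedUnit_pos (β : ℝ) : 0 < unpinnedUnit β := by
  unfold unpinnedUnit; positivity

/-- `unpinnedUnit → 0`. -/
theorem tendsto_unpinnedUnit : Tendsto unpinnedUnit atTop (𝓝 0) := by
  have h : Tendsto (fun β : ℝ => (floorIdx β : ℝ) + 1) atTop atTop :=
    tendsto_atTop_add_const_right _ _ (tendsto_natCast_atTop_atTop.comp tendsto_floorIdx)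
  exact h.inv_tendsto_atTop

/-- **The parasitic unit kills the format below every multiple `T` of its scale (PROVED).**  For every window `n`, every
`ε ≤ 1/16` and every `T`: for all large `β`, `TypShellCondUKPc` (fundamental `SU(2)`, budget `floorBudget n`) FAILS at every
mesh `b ≥ 1` with `unpinnedUnit β · b < T` (all such `b` are `≤ M(β)²`, inside the certified floor). -/
theorem unpinnedUnit_kills (n : ℕ) {ε : ℝ} (hε : ε ≤ 1 / 16) (T : ℝ) :
    ∃ β₂ : ℝ, ∀ β : ℝ, β₂ ≤ β → ∀ b : ℕ, 1 ≤ b → unpinnedUnit β * (b : ℝ) < T →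
      ¬ TypShellCondUKPc (fundamentalRep (Fin 2)) β b n ε (floorBudget n) := by
  obtain ⟨β₂, hβ₂⟩ := tendsto_atTop_atTop.1 tendsto_floorIdx (max (n + 1) ⌈2 * max T 0 + 1⌉₊)
  refine ⟨β₂, fun β hβ b hb hlt hU => ?_⟩
  have hM : max (n + 1) ⌈2 * max T 0 + 1⌉₊ ≤ floorIdx β := hβ₂ β hβ
  have hnM : n ≤ floorIdx β := by omega
  have hM0 : floorIdx β ≠ 0 := by omega
  have hM1 : (1 : ℝ) ≤ (floorIdx β : ℝ) := by exact_mod_cast (show 1 ≤ floorIdx β by omega)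
  have hMT : 2 * max T 0 + 1 ≤ (floorIdx β : ℝ) :=
    (Nat.le_ceil _).trans (by exact_mod_cast (le_max_right _ _).trans hM)
  have hT0 : 0 ≤ max T 0 := le_max_right _ _
  -- `b < T (M+1) ≤ max T 0 · (M+1) ≤ M²`
  have hb1 : (b : ℝ) < ((floorIdx β : ℝ) + 1) * T := by
    have h := hlt
    unfold unpinnedUnit at h
    exact (inv_mul_lt_iff₀ (by positivity)).1 h
  have hb2 : (b : ℝ) < ((floorIdx β : ℝ) + 1) * max T 0 :=
    hb1.trans_le (mul_le_mul_of_nonneg_left (le_max_left _ _) (by positivity))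
  have hb3 : (b : ℝ) < (floorIdx β : ℝ) * (floorIdx β : ℝ) := by
    nlinarith [mul_nonneg (sub_nonneg.2 hMT) (sub_nonneg.2 hM1), mul_nonneg hT0 (sub_nonneg.2 hM1)]
  have hbMM : b ≤ floorIdx β * floorIdx β := by
    have h' : (b : ℝ) < ((floorIdx β * floorIdx β : ℕ) : ℝ) := by push_cast; exact hb3
    exact (Nat.cast_lt.1 h').le
  have hthr : floorThr n (floorIdx β * floorIdx β) ≤ β := floorOK_floorIdx hM0 n hnM
  exact floorThr_spec n _ β hthr b hb hbMM (typShellCond_of_UKPc (typShellCondUKPc_mono_eps hε hU))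

/-- **The parasitic unit, packaged**: a positive unit map `a → 0` of `SU(2)` under which, for every window `n`, every `ε ≤ 1/16`
and every `T`, the format fails for all large `β` at every mesh below `T / a(β)` (budget `floorBudget n`). -/
theorem exists_unpinnedUnit :
    ∃ a : ℝ → ℝ, (∀ β, 0 < a β) ∧ Tendsto a atTop (𝓝 0) ∧
      ∀ (n : ℕ) (ε : ℝ), ε ≤ 1 / 16 → ∀ T : ℝ, ∃ β₂ : ℝ, ∀ β : ℝ, β₂ ≤ β →
        ∀ b : ℕ, 1 ≤ b → a β * (b : ℝ) < T → ¬ TypShellCondUKPc (fundamentalRep (Fin 2)) β b n ε (floorBudget n) :=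
  ⟨unpinnedUnit, unpinnedUnit_pos, tendsto_unpinnedUnit, fun n _ hε T => unpinnedUnit_kills n hε T⟩

end Unpinned


/-! ## §4 The unpinned twins are FALSE -/

/-- **`¬ OnsetSharpUKPcFree` (PROVED, unconditional)**: witness `SU(2)`, fundamental representation, the parasitic unit
`unpinnedUnit`; at the supplier's `(n, ε)` read the floor at `δ = floorBudget n`. -/
theorem not_onsetSharpUKPcFree : ¬ OnsetSharpUKPcFree := by
  intro h
  letI : MeasurableSpace (Matrix.specialUnitaryGroup (Fin 2) ℂ) := borel _
  haveI : BorelSpace (Matrix.specialUnitaryGroup (Fin 2) ℂ) := ⟨rfl⟩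
  obtain ⟨n, ε, -, hε0, hM, hδ⟩ := h (Matrix.specialUnitaryGroup (Fin 2) ℂ)
    (isCompactSimpleLieGroup_specialUnitaryGroup isSimpleCompactGroup_specialUnitaryGroup_holds le_rfl) fundRepSU2
    unpinnedUnit unpinnedUnit_pos tendsto_unpinnedUnit
  obtain ⟨T, β₂, hb⟩ := hδ (floorBudget n) (floorBudget_pos n)
  obtain ⟨β₃, hk⟩ := unpinnedUnit_kills n (eps_le_sixteenth hε0 hM) T
  obtain ⟨b, hb1, hlt, hP⟩ := hb (max β₂ β₃) (le_max_left _ _)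
  exact hk _ (le_max_right _ _) b hb1 hlt hP

/-- **`SimplyConnectedSpace SU(2) → ¬ OnsetSharpUKPcSCFree` (PROVED)** — the SC input is the tree's `simplyConnectedSpace_su2`
(`Theorems/BrascampLiebVacuumSC/Negative/AdmissibleInstance.lean`), supplied in the companion file. -/
theorem not_onsetSharpUKPcSCFree_of_sc (hsc : SimplyConnectedSpace (Matrix.specialUnitaryGroup (Fin 2) ℂ)) :
    ¬ OnsetSharpUKPcSCFree := by
  intro h
  letI : MeasurableSpace (Matrix.specialUnitaryGroup (Fin 2) ℂ) := borel _
  haveI : BorelSpace (Matrix.specialUnitaryGroup (Fin 2) ℂ) := ⟨rfl⟩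
  obtain ⟨n, ε, -, hε0, hM, hδ⟩ := h (Matrix.specialUnitaryGroup (Fin 2) ℂ)
    (isCompactSimpleLieGroup_specialUnitaryGroup isSimpleCompactGroup_specialUnitaryGroup_holds le_rfl) hsc fundRepSU2
    unpinnedUnit unpinnedUnit_pos tendsto_unpinnedUnit
  obtain ⟨T, β₂, hb⟩ := hδ (floorBudget n) (floorBudget_pos n)
  obtain ⟨β₃, hk⟩ := unpinnedUnit_kills n (eps_le_sixteenth hε0 hM) T
  obtain ⟨b, hb1, hlt, hP⟩ := hb (max β₂ β₃) (le_max_left _ _)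
  exact hk _ (le_max_right _ _) b hb1 hlt hP


/-! ## §5 The EXACT kill-world of the registered stub -/

/-- **`SubscaleFailureSC`** — the exact negation of I♯_SC, as a world: one PINNED simply connected `(G, r, a)` (positive,
`a → 0`, `LowerBounds G r a`) at which, for every admissible `(n, ε)`, some budget `δ > 0` sees, for every `T` and frequently in
`β`, the format `TypShellCondUKPc` fail at EVERY mesh `b ≥ 1` with `a β · b < T`. -/
def SubscaleFailureSC : Prop :=
  ∃ (G : Type) (_ : Group G) (_ : TopologicalSpace G) (_ : IsTopologicalGroup G) (_ : CompactSpace G),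
    IsCompactSimpleLieGroup G ∧ SimplyConnectedSpace G ∧
      (letI : MeasurableSpace G := borel G; haveI : BorelSpace G := ⟨rfl⟩;
        ∃ (r : LatticeRep G) (a : ℝ → ℝ), (∀ β, 0 < a β) ∧ Tendsto a atTop (𝓝 0) ∧ LowerBounds G r a ∧
          ∀ (n : ℕ) (ε : ℝ), 1 ≤ n → 0 ≤ ε → ε * OnsetFormats.shellCount n ≤ 3 / 4 →
            ∃ δ : ℝ, 0 < δ ∧ ∀ T β₂ : ℝ, ∃ β : ℝ, β₂ ≤ β ∧
              ∀ b : ℕ, 1 ≤ b → a β * (b : ℝ) < T → ¬ TypShellCondUKPc r.ρ β b n ε δ)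

/-- **`SubscaleFailureSC ↔ ¬ I♯_SC` (PROVED; pure logic).**  This — not `LateOnsetAt` — is what a refuter of `stub_onsetSharpSC`
has to instantiate; it needs a PINNED unit map, i.e. a `LowerBounds` witness, which is why the verdict of record is (B). -/
theorem subscaleFailureSC_iff_not : SubscaleFailureSC ↔ ¬ OnsetSharpUKPcSC := by
  constructor
  · rintro ⟨G, _, _, _, _, hG, hsc, hrest⟩ hS
    letI : MeasurableSpace G := borel G
    haveI : BorelSpace G := ⟨rfl⟩
    obtain ⟨r, a, ha, hat, hlb, hall⟩ := hrest
    obtain ⟨n, ε, hn, hε, hM, hδT⟩ := hS G hG hsc r a ha hat hlb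
    obtain ⟨δ, hδ, hfail⟩ := hall n ε hn hε hM
    obtain ⟨T, β₂, hb⟩ := hδT δ hδ
    obtain ⟨β, hβ, hno⟩ := hfail T β₂
    obtain ⟨b, hb1, hlt, hP⟩ := hb β hβ
    exact hno b hb1 hlt hP
  · intro hS
    by_contra hW
    apply hS
    intro G _ _ _ _ hG hsc
    letI : MeasurableSpace G := borel G
    haveI : BorelSpace G := ⟨rfl⟩
    intro r a ha hat hlb
    by_contra hne
    apply hW
    refine ⟨G, inferInstance, inferInstance, inferInstance, inferInstance, hG, hsc, r, a, ha, hat, hlb, ?_⟩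
    intro n ε hn hε hM
    by_contra hδ
    apply hne
    refine ⟨n, ε, hn, hε, hM, fun δ hδ0 => ?_⟩
    by_contra hT
    apply hδ
    refine ⟨δ, hδ0, fun T β₂ => ?_⟩
    by_contra hβ
    apply hT
    refine ⟨T, β₂, fun β hβ2 => ?_⟩
    by_contra hb
    exact hβ ⟨β, hβ2, fun b hb1 hlt hP => hb ⟨b, hb1, hlt, hP⟩⟩

/-- **The §5 hook of record is a special case (PROVED)**: late onset (`AfPincerUc.LateOnsetAt`, p528589 currency) at every
admissible `(n, ε)` of one pinned simply connected `(G, r, a)` gives `SubscaleFailureSC` (drop its «holds at some larger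
mesh» clause and weaken `≤ T` to `< T`). -/
theorem subscaleFailureSC_of_lateOnset (G : Type) [Group G] [TopologicalSpace G] [IsTopologicalGroup G]
    [CompactSpace G] (hG : IsCompactSimpleLieGroup G) (hsc : SimplyConnectedSpace G)
    (h : letI : MeasurableSpace G := borel G; haveI : BorelSpace G := ⟨rfl⟩;
      ∃ (r : LatticeRep G) (a : ℝ → ℝ), (∀ β, 0 < a β) ∧ Tendsto a atTop (𝓝 0) ∧ LowerBounds G r a ∧
        ∀ (n : ℕ) (ε : ℝ), 1 ≤ n → 0 ≤ ε → ε * OnsetFormats.shellCount n ≤ 3 / 4 →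
          ∃ δ : ℝ, 0 < δ ∧ LateOnsetAt r a n ε δ) : SubscaleFailureSC := by
  letI : MeasurableSpace G := borel G
  haveI : BorelSpace G := ⟨rfl⟩
  obtain ⟨r, a, ha, hat, hlb, hall⟩ := h
  refine ⟨G, inferInstance, inferInstance, inferInstance, inferInstance, hG, hsc, r, a, ha, hat, hlb, ?_⟩
  intro n ε hn hε hM
  obtain ⟨δ, hδ, hlate⟩ := hall n ε hn hε hM
  refine ⟨δ, hδ, fun T β₂ => ?_⟩
  obtain ⟨β, hβ, -, hfail⟩ := hlate T β₂
  exact ⟨β, hβ, fun b hb1 hlt => hfail b hb1 hlt.le⟩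

end Summit.QuantumFields.YangMills.Cruxes.IR.AfPincerUc.SharpOnset

end
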